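import Summits.BirchSwinnertonDyer.BirchSwinnertonDyer.Theorems.KolyvaginDepthDoorKolyvaginDepthSupplyDoorOfDatumPrint
import Summits.BirchSwinnertonDyer.BirchSwinnertonDyer.Theorems.KolyvaginDepthDoorKNSupplyLevelOneStructure
import HarnessLib

/-!
# Route `KolyvaginDepthDoor`, crux `KolyvaginDepthSupplyKN` (stmt-BirchSwinnertonDyer-22820) —
# THE RANK-2 SLICE AT LEVEL ONE: per `(E, p, K)` the depth table's bit «`c_1(ℓ) ≠ 0` for some
# Kolyvagin prime `ℓ`» IS «`Ш(E/ℚ)[p] = 0`», modulo (γ) (door) and W. Zhang 2014 Lemma 8.4 (1) (supply)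

Helper file (`--supports stmt-BirchSwinnertonDyer-22820 --as helper`); it closes nothing and BSD is
not proved by it. The critic's price of the D-0145 line («depth table / rank-2 slice only») in the
currency of the RE-TYPED crux (level-one classes on the Kodaira–Néron cell; the old slice
`kolyvaginClass_prime_ne_zero_iff_shaCorank_eq_zero_of_rank_two` is in the `p^∞`/corank currency,
modulo BCGS 2026 Thm. 1 + Kolyvagin 1991 Thm. 4, which cannot produce a LEVEL-ONE class).

Setting: `E/ℚ` non-CM globally minimal of Mordell–Weil rank `2`; `p ≥ 5` good ordinary with the
tower `ρ̄_{E,p^n}` onto and the Kodaira–Néron condition (in both currencies: `p ∤ ord_v(Δ_min)` for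
the door, `p ∤ v_ℓ(Δ_min)` = Hypothesis ♠ (1) for the supply), Hypothesis ♠ (2); `K` imaginary
quadratic Heegner with `d_K ≠ −3, −4`, `p ∤ d_K`, `(d_K, N) = 1`; the TWIST side pinned:
`rank E^{(d_K)}(ℚ) ≤ 1` and `Ш(E^{(d_K)}/ℚ)[p] = 0` (as the line's skeleton arranges: `K` from
Bump–Friedberg–Hoffstein / Hoffstein–Luo + GZK, `p > #Ш(E^{(d_K)})`).

* `exists_kolyvaginClass_one_prime_ne_zero_of_rank_two_of_sha_trivial` — SUPPLY (modulo the named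
  fact `WZhang2014_lemma84_exists_minimal_kolyvaginClass_one_selmerCard`, p659238): `Ш(E/ℚ)[p] = 0`
  FORCES a level-one class `c_1(ℓ) ≠ 0` on exactly ONE Kolyvagin prime `ℓ`, and every depth-`0`
  class `c_1(1)` of that frame vanishes (`y_K` dies mod `p`). Proof: exact descent counts
  `#Sel_p(E) = p²`, `#Sel_p(E^{(d_K)}) = p^{rank E^{(d_K)}} ≤ p`; at Zhang's minimal class the
  dichotomy reads `p² = p^{ν+1}` (so `ν = 1`) or `p^{rank'} = p^{ν+1} ∧ p² ≤ p^ν` (impossible: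
  `ν + 1 = rank' ≤ 1`). A square-free `n` with one prime factor is prime.
* `kolyvaginClass_one_prime_ne_zero_iff_sha_trivial_of_rank_two` — **THE SLICE**: under the setting,
  `(∃ frame, Kolyvagin prime ℓ, datum of conductor ℓ with c_1(ℓ) ≠ 0) ↔ Ш(E/ℚ)[p] = 0`. `→` is the
  landed KN door of a datum (`shaCorank_eq_zero_of_kolyvaginClass_ne_zero_of_rank_le_of_datum_kodairaNeron`,
  g8/g9, modulo (γ) = `GrossLMS1991.prop37_2_frobeniusCongruence` only); `←` is the supply above.
  So at rank 2 the depth table's question at `(E, p, K)` is EXACTLY «`Ш(E)[p] = 0`» — an instrument,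
  JLS-computable row by row, not distance to the summit.

CONDITIONAL on the two named facts ((γ): Gross 1991 Prop. 3.7 (2); Zhang 2014 Lemma 8.4 (1) +
Thm. 9.1), both theorems in print; nothing class-wide is discharged and BSD is NOT proved by this.

References: [WZhang2014] Lemma 8.4 (1) (p. 236), Thm. 9.1 (p. 240); [GrossLMS1991] Prop. 3.7 (2);
[Kolyvagin1991MathAnn] Thm. 2.3; [SilvermanAEC2009] X.4.2; [JetchevLauterStein2009] §3.6.
-/

set_option linter.dupNamespace false

noncomputable section

open scoped Classical NumberField

namespace Summit.BirchSwinnertonDyer.BirchSwinnertonDyer.Theorems.KolyvaginDepthDoor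

open Literature.NumberTheory.EllipticCurves Literature.NumberTheory.EllipticCurves.ModularForms
  WeierstrassCurve NumberField IsDedekindDomain
open Literature.NumberTheory.DiophantineGeometry (KodairaSymbol)

/-- A square-free natural number with exactly one prime factor is prime (bookkeeping for
`ν(n) = 1`). [folklore] -/
private theorem prime_of_squarefree_of_card_primeFactors_eq_one' {n : ℕ} (hsq : Squarefree n)
    (h1 : n.primeFactors.card = 1) : n.Prime := by
  obtain ⟨ℓ, hℓ⟩ := Finset.card_eq_one.mp h1
  have hℓmem : ℓ ∈ n.primeFactors := by rw [hℓ]; exact Finset.mem_singleton_self ℓ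
  have hℓp : ℓ.Prime := Nat.prime_of_mem_primeFactors hℓmem
  have hprod : ∏ q ∈ n.primeFactors, q = n := Nat.prod_primeFactors_of_squarefree hsq
  rw [hℓ, Finset.prod_singleton] at hprod
  rw [← hprod]
  exact hℓp

/-- **Supply at rank 2, level one (modulo W. Zhang 2014 Lemma 8.4 (1) + Thm. 9.1).** `E/ℚ` globally
minimal of Mordell–Weil rank `2`; `p ≥ 5` good ordinary with `ρ̄_{E,p}` onto; Hypothesis ♠ (1)–(2);
`K` imaginary quadratic Heegner with `p ∤ d_K`, `(d_K, N) = 1`; `rank E^{(d_K)}(ℚ) ≤ 1` and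
`Ш(E^{(d_K)}/ℚ)[p] = 0`. IF `Ш(E/ℚ)[p] = 0` THEN there are a frame `(Dt, β, ι)`, ONE Kolyvagin prime
`ℓ` (W. Zhang's sense) and a datum of conductor `ℓ` with `c_1(ℓ) ≠ 0` in `H¹(K, E[p])`, and EVERY
depth-`0` class `c_1(1)` of the frame vanishes. (Descent counts `#Sel_p(E) = p²`,
`#Sel_p(E^{(d_K)}) ≤ p`; Zhang's dichotomy at the minimal class forces the `E`-side with `ν = 1`.)
CONDITIONAL on `h84`; BSD is not proved by it. [cite: WZhang2014, Lemma 8.4 (1) (p. 236), Thm. 9.1 (p. 240)]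
[cite: SilvermanAEC2009, Thm. X.4.2] -/
theorem exists_kolyvaginClass_one_prime_ne_zero_of_rank_two_of_sha_trivial
    (h84 : WZhang2014_lemma84_exists_minimal_kolyvaginClass_one_selmerCard)
    (W : WeierstrassCurve ℚ) [W.IsElliptic] [W.IsGloballyMinimal] (hr : W.mordellWeilRank = 2)
    (p : ℕ) [hp : Fact p.Prime] (h5 : 5 ≤ p) (hgood : W.HasGoodReductionAtPrime p)
    (hord : ¬ (p : ℤ) ∣ W.frobeniusTrace p) (hsurj : W.HasSurjectiveModNGaloisRep p)
    (hS1 : ∀ (ℓ : ℕ) [Fact ℓ.Prime], W.HasMultiplicativeReductionAtPrime ℓ →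
      ¬ p ∣ padicValInt ℓ W.minimalDiscriminantInt)
    (hS2 : ¬ Squarefree (W.conductorNorm ℤ) →
      (∃ (ℓ : ℕ) (_ : Fact ℓ.Prime), W.HasMultiplicativeReductionAtPrime ℓ ∧
          ¬ p ∣ padicValInt ℓ W.minimalDiscriminantInt) ∧
        ∃ (ℓ₁ ℓ₂ : ℕ) (_ : Fact ℓ₁.Prime) (_ : Fact ℓ₂.Prime), ℓ₁ ≠ ℓ₂ ∧
          W.HasMultiplicativeReductionAtPrime ℓ₁ ∧ W.HasMultiplicativeReductionAtPrime ℓ₂)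
    (K : Type) [Field K] [NumberField K] (hK : IsImaginaryQuadratic K)
    (hpD : ¬ ((p : ℤ) ∣ NumberField.discr K))
    (hDN : IsCoprime (NumberField.discr K) ((W.conductorNorm ℤ : ℕ) : ℤ))
    [NeZero (W.conductorNorm ℤ)] (hHeeg : SatisfiesHeegnerHypothesis (W.conductorNorm ℤ) K)
    (hT1 : (W.quadraticTwist (NumberField.discr K : ℚ)).mordellWeilRank ≤ 1)
    (hshaT : ((W.quadraticTwist (NumberField.discr K : ℚ)).sha ⊓
        AddSubgroup.torsionBy (W.quadraticTwist (NumberField.discr K : ℚ)).galH1 (p : ℤ) :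
        AddSubgroup (W.quadraticTwist (NumberField.discr K : ℚ)).galH1) = ⊥)
    (hshaW : (W.sha ⊓ AddSubgroup.torsionBy W.galH1 (p : ℤ) : AddSubgroup W.galH1) = ⊥) :
    ∃ (Dt : ModularParametrizationData W (W.conductorNorm ℤ)) (β : ℤ) (ι : K →+* ℂ) (ℓ : ℕ)
      (d : KolyvaginHeegnerData Dt β ι ℓ),
      ℓ.Prime ∧ Zhang2014.IsKolyvaginPrime (W.conductorNorm ℤ) W K p ℓ ∧
        d.kolyvaginClass hp.out 1 ≠ 0 ∧
        ∀ d₀ : KolyvaginHeegnerData Dt β ι 1, d₀.kolyvaginClass hp.out 1 = 0 := by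
  obtain ⟨Dt, β, ι, n, d, hsupp, -, hne, hmin, hdich⟩ :=
    h84 W p h5 hgood hord hsurj hS1 hS2 K hK hpD hDN hHeeg
  have hpP : p.Prime := hp.out
  have h2p : 2 ≤ p := hpP.two_le
  haveI : NeZero (p : ℚ) := ⟨by exact_mod_cast hpP.ne_zero⟩
  have hirr : W.HasIrreducibleModPGaloisRep p :=
    hasIrreducibleModPGaloisRep_of_hasSurjectiveModNGaloisRep W p hsurj
  have hdK : (NumberField.discr K : ℚ) ≠ 0 := by exact_mod_cast NumberField.discr_ne_zero K
  haveI := W.isElliptic_quadraticTwist hdK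
  have hirrT : (W.quadraticTwist (NumberField.discr K : ℚ)).HasIrreducibleModPGaloisRep p :=
    (W.hasIrreducibleModPGaloisRep_quadraticTwist_iff hdK p).mpr hirr
  have hSelW : Nat.card (W.selmerGroup p) = p ^ 2 := by
    rw [← hr]; exact natCard_selmerGroup_eq_pow_rank_of_sha_inf_torsionBy_eq_bot W p hirr hshaW
  have hSelT : Nat.card ((W.quadraticTwist (NumberField.discr K : ℚ)).selmerGroup p) =
      p ^ (W.quadraticTwist (NumberField.discr K : ℚ)).mordellWeilRank :=
    natCard_selmerGroup_eq_pow_rank_of_sha_inf_torsionBy_eq_bot _ p hirrT hshaT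
  -- the minimal non-zero level-one class has depth exactly `1`
  have hν : n.primeFactors.card = 1 := by
    rcases hdich with ⟨hW1, -⟩ | ⟨hT1', hW2⟩
    · rw [hSelW] at hW1
      have := Nat.pow_right_injective h2p hW1
      omega
    · exfalso
      rw [hSelT] at hT1'
      have h1 := Nat.pow_right_injective h2p hT1'
      have h0 : n.primeFactors.card = 0 := by omega
      rw [hSelW, h0, pow_zero] at hW2
      have : 2 ^ 2 ≤ p ^ 2 := Nat.pow_le_pow_left h2p 2
      omega
  have hn : n.Prime := prime_of_squarefree_of_card_primeFactors_eq_one' hsupp.1 hν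
  have hmem : n ∈ n.primeFactors := by
    rw [hn.primeFactors]; exact Finset.mem_singleton_self n
  refine ⟨Dt, β, ι, n, d, hn, hsupp.2 n hmem, hne, fun d₀ ↦ ?_⟩
  -- every depth-0 class of the frame vanishes, by minimality
  by_contra h0
  have := hmin 1 d₀ (KolyvaginDescent.kolSupp_one _) h0
  rw [hν, Nat.primeFactors_one, Finset.card_empty] at this
  omega

/-- **THE RANK-2 SLICE AT LEVEL ONE, per `(E, p, K)` (modulo (γ) and W. Zhang 2014 Lemma 8.4 (1)).**
`E/ℚ` non-CM globally minimal of Mordell–Weil rank `2`; `p ≥ 5` good ordinary with `ρ̄_{E,p^n}` onto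
for all `n`, on the Kodaira–Néron cell (`p ∤ ord_v(Δ_min)` at multiplicative places AND
`p ∤ v_ℓ(Δ_min)` at multiplicative primes — the same condition in the door's and in Zhang's
currency) with Hypothesis ♠ (2); `K` imaginary quadratic Heegner, `d_K ≠ −3, −4`, `p ∤ d_K`,
`(d_K, N) = 1`; twist side pinned: `rank E^{(d_K)}(ℚ) ≤ 1`, `Ш(E^{(d_K)}/ℚ)[p] = 0`. THEN:
«some frame, some Kolyvagin prime `ℓ`, some datum of conductor `ℓ` with `c_1(ℓ) ≠ 0`» `↔`
«`Ш(E/ℚ)[p] = 0`». `→`: the KN door of a datum (g8/g9, (γ) only); `←`: the supply above (Zhang).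
The depth table's bit at a rank-2 row is EXACTLY `Ш(E)[p] = 0`. CONDITIONAL on `h372`, `h84`;
per-curve; BSD is not proved by it. [cite: GrossLMS1991, Prop. 3.7 (2)]
[cite: WZhang2014, Lemma 8.4 (1) (p. 236), Thm. 9.1 (p. 240)] [cite: Kolyvagin1991MathAnn, Thm. 2.3]
[cite: JetchevLauterStein2009, §3.6] -/
theorem kolyvaginClass_one_prime_ne_zero_iff_sha_trivial_of_rank_two
    (h372 : GrossLMS1991.prop37_2_frobeniusCongruence)
    (h84 : WZhang2014_lemma84_exists_minimal_kolyvaginClass_one_selmerCard)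
    (W : WeierstrassCurve ℚ) [W.IsElliptic] [W.IsGloballyMinimal] (hcm : ¬ W.HasCM)
    (hr : W.mordellWeilRank = 2)
    (p : ℕ) [hp : Fact p.Prime] (h5 : 5 ≤ p) (hgood : W.HasGoodReductionAtPrime p)
    (hord : ¬ (p : ℤ) ∣ W.frobeniusTrace p)
    (htower : ∀ n : ℕ, W.HasSurjectiveModNGaloisRep (p ^ n : ℕ))
    (hmult : ∀ v : HeightOneSpectrum (𝓞 ℚ), W.HasMultiplicativeReductionAt v →
      ¬ p ∣ W.ordMinimalDiscriminant v)
    (hS1 : ∀ (ℓ : ℕ) [Fact ℓ.Prime], W.HasMultiplicativeReductionAtPrime ℓ →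
      ¬ p ∣ padicValInt ℓ W.minimalDiscriminantInt)
    (hS2 : ¬ Squarefree (W.conductorNorm ℤ) →
      (∃ (ℓ : ℕ) (_ : Fact ℓ.Prime), W.HasMultiplicativeReductionAtPrime ℓ ∧
          ¬ p ∣ padicValInt ℓ W.minimalDiscriminantInt) ∧
        ∃ (ℓ₁ ℓ₂ : ℕ) (_ : Fact ℓ₁.Prime) (_ : Fact ℓ₂.Prime), ℓ₁ ≠ ℓ₂ ∧
          W.HasMultiplicativeReductionAtPrime ℓ₁ ∧ W.HasMultiplicativeReductionAtPrime ℓ₂)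
    (K : Type) [Field K] [NumberField K] (hK : IsImaginaryQuadratic K)
    (hD3 : NumberField.discr K ≠ -3) (hD4 : NumberField.discr K ≠ -4)
    (hpD : ¬ ((p : ℤ) ∣ NumberField.discr K))
    (hDN : IsCoprime (NumberField.discr K) ((W.conductorNorm ℤ : ℕ) : ℤ))
    [NeZero (W.conductorNorm ℤ)] (hH : SatisfiesHeegnerHypothesis (W.conductorNorm ℤ) K)
    (hT1 : (W.quadraticTwist (NumberField.discr K : ℚ)).mordellWeilRank ≤ 1)
    (hshaT : ((W.quadraticTwist (NumberField.discr K : ℚ)).sha ⊓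
        AddSubgroup.torsionBy (W.quadraticTwist (NumberField.discr K : ℚ)).galH1 (p : ℤ) :
        AddSubgroup (W.quadraticTwist (NumberField.discr K : ℚ)).galH1) = ⊥) :
    (∃ (Dt : ModularParametrizationData W (W.conductorNorm ℤ)) (β : ℤ) (ι : K →+* ℂ) (ℓ : ℕ)
      (d : KolyvaginHeegnerData Dt β ι ℓ),
      ℓ.Prime ∧ Zhang2014.IsKolyvaginPrime (W.conductorNorm ℤ) W K p ℓ ∧
        d.kolyvaginClass hp.out 1 ≠ 0) ↔
    (W.sha ⊓ AddSubgroup.torsionBy W.galH1 (p : ℤ) : AddSubgroup W.galH1) = ⊥ := by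
  have hp2 : p ≠ 2 := by omega
  have hsurj : W.HasSurjectiveModNGaloisRep p := by simpa only [pow_one] using htower 1
  constructor
  · -- the door of a datum on the Kodaira–Néron cell, (γ) only
    rintro ⟨Dt, β, ι, ℓ, d, hℓ, hkol, hne⟩
    obtain ⟨c, hc, hcc⟩ := exists_conj_of_isImaginaryQuadratic K hK
    have hadd : ∀ v : HeightOneSpectrum (𝓞 ℚ), W.HasAdditiveReductionAt v → p ≠ 3 ∨
        (W.kodairaSymbolAt v ≠ KodairaSymbol.IV ∧ W.kodairaSymbolAt v ≠ KodairaSymbol.IVstar) :=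
      fun _ _ ↦ Or.inl (by omega)
    have hk : ∀ q ∈ ℓ.primeFactors, Zhang2014.IsKolyvaginPrime (W.conductorNorm ℤ) W K p q := by
      intro q hq
      rw [hℓ.primeFactors, Finset.mem_singleton] at hq
      exact hq ▸ hkol
    have hrank : ℓ.primeFactors.card + 1 ≤ W.mordellWeilRank := by
      rw [hℓ.primeFactors, Finset.card_singleton, hr]
    obtain ⟨-, -, -, -, hbot, -⟩ :=
      shaCorank_eq_zero_of_kolyvaginClass_ne_zero_of_rank_le_of_datum_kodairaNeron h372 hcm hK hD3 hD4
        hH p hp2 htower c hc hcc hmult hadd hℓ.squarefree hk d hne hrank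
    simpa only [pow_one] using hbot
  · -- the supply (Zhang)
    intro hshaW
    obtain ⟨Dt, β, ι, ℓ, d, hℓ, hkol, hne, -⟩ :=
      exists_kolyvaginClass_one_prime_ne_zero_of_rank_two_of_sha_trivial h84 W hr p h5 hgood hord hsurj
        hS1 hS2 K hK hpD hDN hH hT1 hshaT hshaW
    exact ⟨Dt, β, ι, ℓ, d, hℓ, hkol, hne⟩

end Summit.BirchSwinnertonDyer.BirchSwinnertonDyer.Theorems.KolyvaginDepthDoor

end
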